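import Mathlib.Analysis.InnerProductSpace.Projection.Basic
import Mathlib.Analysis.Calculus.InverseFunctionTheorem.FDeriv
import Mathlib.Topology.Connected.Clopen
import Mathlib.LinearAlgebra.FiniteDimensional.Lemmas
import HarnessLib

/-!
# Algebraic and topological core of White's rigidity theorem for self-shrinking slices

Topic `Literature/Geometry/Riemannian`.  White 2005, Prop. 2.10 and the discussion before it
(p. 1496–1497): an entire proper mean curvature flow all of whose Gaussian density ratios are `1`
is a static multiplicity-one plane.  In the route used for the tree's discharge of White's local
regularity theorem the equality case of Huisken's monotonicity formula gives, for a slice `M(t)`,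
a point `y ∈ M(t)` and EVERY later centre `X = (x, s)` on the flow, the shrinker identity
`H⃗(y, t) = -(y - x)^⊥ / (2(s - t))`, `⊥` the component normal to `T_y M(t)`.  This file isolates
the elementary consequences:

* `normalPart_sub_eq_const_of_shrinker` — the normal parts `(y - x)^⊥`, `x ∈ M(s)`, are then all
  equal to `c = -2(s - t) H⃗(y, t)`;
* `sub_mem_of_normalPart_sub_eq` — hence `M(s) ⊆ (y - c) + T_y M(t)`, an affine plane parallel
  to the tangent plane (`K` any complete subspace,
  `Kᗮ.starProjection (y - x) = c ⟹ x - (y - c) ∈ K`);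
* `image_mem_nhds_of_hasStrictFDerivAt` — a `C¹` germ with injective differential whose
  image lies in an affine plane of the SAME dimension covers a relative neighbourhood of its value
  (inverse function theorem): the slice is relatively open in the plane;
* `eq_of_subset_of_isPreconnected_of_relClopen` — a nonempty, relatively closed, relatively open
  subset of a (pre)connected set is the whole set: the slice IS the plane.

Everything is PROVED; no definitions, no named facts.

## References

* B. White, *A local regularity theorem for mean curvature flow*, Ann. of Math. 161 (2005),
  §2.10 and p. 1496. [White2005]
* G. Huisken, *Asymptotic behavior for singularities of the mean curvature flow*, J. Differential
  Geom. 31 (1990), Thm. 3.1 (equality case). [Huisken1990]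
-/

noncomputable section

open Set Filter Topology

namespace Literature.Geometry.Riemannian

section Algebra

variable {V : Type*} [NormedAddCommGroup V] [InnerProductSpace ℝ V]

omit [InnerProductSpace ℝ V] in
/-- **The shrinker identity for all centres forces a constant normal part.**  If for every `x ∈ S`
`Hv = -(1/(2σ)) • P (y - x)` (`P` any map, e.g. the projection to the normal space, `σ ≠ 0`),
then `P (y - x) = (-2σ) • Hv` for all `x ∈ S`. [cite: White2005, §2.10 p. 1496] -/
theorem normalPart_sub_eq_const_of_shrinker {W : Type*} [AddCommGroup W] [Module ℝ W]
    {P : V → W} {S : Set V} {y : V} {Hv : W} {σ : ℝ} (hσ : σ ≠ 0)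
    (h : ∀ x ∈ S, Hv = (-(1 / (2 * σ))) • P (y - x)) :
    ∀ x ∈ S, P (y - x) = (-(2 * σ)) • Hv := by
  intro x hx
  rw [h x hx, smul_smul]
  have : -(2 * σ) * -(1 / (2 * σ)) = 1 := by field_simp
  rw [this, one_smul]

/-- **Constant normal part ⟹ containment in a parallel affine plane.**  For a subspace `K` with
orthogonal projection: if `Kᗮ.starProjection (y - x) = c` then `x - (y - c) ∈ K`, i.e.
`x ∈ (y - c) + K`. [cite: White2005, §2.10 p. 1496] -/
theorem sub_mem_of_normalPart_sub_eq (K : Submodule ℝ V) [K.HasOrthogonalProjection] {y x c : V}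
    (h : Kᗮ.starProjection (y - x) = c) : x - (y - c) ∈ K := by
  have hK : K.starProjection (y - x) ∈ K := Submodule.starProjection_apply_mem K (y - x)
  have hsum : K.starProjection (y - x) + Kᗮ.starProjection (y - x) = y - x :=
    Submodule.starProjection_add_starProjection_orthogonal (K := K) (y - x)
  have hc : Kᗮ.starProjection (y - x) = (y - x) - K.starProjection (y - x) :=
    eq_sub_of_add_eq' hsum
  have hx : x - (y - c) = -K.starProjection (y - x) := by
    rw [← h, hc]; abel
  rw [hx]
  exact K.neg_mem hK

/-- The set of points whose normal part relative to `y` equals `c` is contained in the affine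
plane `(y - c) + K`. [cite: White2005, §2.10 p. 1496] -/
theorem subset_vadd_of_normalPart_sub_eq (K : Submodule ℝ V) [K.HasOrthogonalProjection]
    {S : Set V} {y c : V} (h : ∀ x ∈ S, Kᗮ.starProjection (y - x) = c) :
    S ⊆ (fun k : V => (y - c) + k) '' (K : Set V) := fun x hx =>
  ⟨x - (y - c), sub_mem_of_normalPart_sub_eq K (h x hx), by abel⟩

end Algebra

section Topology

/-- **A nonempty relatively clopen subset of a preconnected set is the whole set.**
[folklore] -/
theorem eq_of_subset_of_isPreconnected_of_relClopen {X : Type*} [TopologicalSpace X]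
    {P S : Set X} (hP : IsPreconnected P) (hSP : S ⊆ P) (hne : S.Nonempty)
    (hopen : ∃ U : Set X, IsOpen U ∧ P ∩ U = S) (hclosed : ∃ C : Set X, IsClosed C ∧ P ∩ C = S) :
    S = P := by
  obtain ⟨U, hU, hUS⟩ := hopen
  obtain ⟨C, hC, hCS⟩ := hclosed
  refine hSP.antisymm fun z hz => ?_
  -- `P ⊆ U ∪ Cᶜ` fails to separate: use preconnectedness with the open sets `U` and `Cᶜ`
  by_contra hzS
  have hzU : z ∉ U := fun h => hzS (hUS ▸ ⟨hz, h⟩)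
  have hzC : z ∉ C := fun h => hzS (hCS ▸ ⟨hz, h⟩)
  -- `P ⊆ U ∪ Cᶜ`: a point of `P` in `C` lies in `S ⊆ U`
  have hcover : P ⊆ U ∪ Cᶜ := fun w hw => by
    by_cases hwC : w ∈ C
    · exact Or.inl ((hCS ▸ ⟨hw, hwC⟩ : w ∈ S) |> fun h => (hUS.symm ▸ h : w ∈ P ∩ U).2)
    · exact Or.inr hwC
  obtain ⟨x₀, hx₀⟩ := hne
  have h1 : (P ∩ U).Nonempty := ⟨x₀, hUS.symm ▸ hx₀⟩
  have h2 : (P ∩ Cᶜ).Nonempty := ⟨z, hz, hzC⟩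
  obtain ⟨w, hwP, hwU, hwC⟩ := hP U Cᶜ hU hC.isOpen_compl hcover h1 h2
  exact hwC ((hCS ▸ (show w ∈ S from hUS ▸ ⟨hwP, hwU⟩) : w ∈ P ∩ C).2)

end Topology

section InverseFunction

variable {E P : Type*} [NormedAddCommGroup E] [NormedSpace ℝ E] [CompleteSpace E]
  [NormedAddCommGroup P] [NormedSpace ℝ P]
  [FiniteDimensional ℝ E] [FiniteDimensional ℝ P]

/-- **Same-dimensional `C¹` germs with injective differential are locally onto** (inverse function
theorem): if `g : E → P` is strictly differentiable at `u₀` with injective differential and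
`dim E = dim P`, then the image of every neighbourhood of `u₀` is a neighbourhood of `g u₀`.
Applied to a local parametrization of a slice contained in an affine plane of its own dimension,
the slice is relatively open in the plane. [folklore] -/
theorem image_mem_nhds_of_hasStrictFDerivAt {g : E → P} {A : E →L[ℝ] P} {u₀ : E}
    (hg : HasStrictFDerivAt g A u₀) (hA : Function.Injective A)
    (hdim : Module.finrank ℝ E = Module.finrank ℝ P) {N : Set E} (hN : N ∈ 𝓝 u₀) :
    g '' N ∈ 𝓝 (g u₀) := by
  -- `A` is a linear equivalence
  have hsurj : Function.Surjective A := by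
    have h := LinearMap.injective_iff_surjective_of_finrank_eq_finrank (f := (A : E →ₗ[ℝ] P)) hdim
    exact h.1 hA
  set e : E ≃L[ℝ] P := (LinearEquiv.ofBijective (A : E →ₗ[ℝ] P) ⟨hA, hsurj⟩).toContinuousLinearEquiv
    with he
  have heA : (e : E →L[ℝ] P) = A := by
    ext v; rfl
  have hge : HasStrictFDerivAt g (e : E →L[ℝ] P) u₀ := by
    rw [heA]; exact hg
  have hmap := hge.map_nhds_eq_of_equiv
  rw [← hmap]
  exact Filter.image_mem_map hN

end InverseFunction

end Literature.Geometry.Riemannian
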